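import Literature.AlgebraicGeometry.Motives.QuadraticFormHessian
import Literature.AlgebraicGeometry.Motives.SplitForms
import Mathlib.LinearAlgebra.QuadraticForm.IsometryEquiv
import Mathlib.FieldTheory.IsAlgClosed.Basic
import Mathlib.Algebra.MvPolynomial.Funext
import HarnessLib

/-!
# The split normal form `x₀x₁ + x₂x₃ + ⋯` of a nonsingular quadratic form (any number of variables)

Over an algebraically closed field `k` with `2 ≠ 0`, a quadratic form `F(x₀, …, x_N)` satisfying the
Jacobian criterion is, after an invertible linear substitution, the **split form**
`splitForm N = x₀x₁ + x₂x₃ + ⋯` (`+ x_N²` when `N` is even, i.e. an odd number of variables):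
`exists_linearSubst_splitForm`. The Hessian / nondegeneracy part is `Motives/QuadraticFormHessian`
(any `N`); here the explicit equivalence `Σ sᵢ²uᵢ² ↦ splitForm` (`toSplitMap`: pairs
`y_{2i} = t_{2i} + c t_{2i+1}`, `2y_{2i+1} = t_{2i} - c t_{2i+1}`, and `y_N = h t_N` with `h² = ½`
for the unpaired last variable; `c² = -1`) and the bookkeeping over even/odd indices.

This is the normal form entering the cellular computation of `CH₁` of smooth quadric
hypersurfaces of any dimension (Tian–Zong Thm. 1.7 for `c = 1`, `d = 2`).

Everything is proved; no named facts.

## References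

* J.-P. Serre, *A Course in Arithmetic*, IV §1 (quadratic forms over algebraically closed fields).
  [folklore]
* R. Hartshorne, *Algebraic Geometry*, I Ex. 5.8. [Hartshorne1977]
-/

noncomputable section

open CategoryTheory AlgebraicGeometry Order

universe u

namespace Literature.AlgebraicGeometry.Motives

namespace ProjectiveSpaceCells

open _root_.MvPolynomial Matrix

section SplitForm

variable {k : Type u} [Field k] {N : ℕ}

/-- **The explicit equivalence `Σ sᵢ²uᵢ² ↦ 2 · splitForm`.** [folklore] -/
def toSplitMap (s : Fin (N + 1) → k) (c h : k) : (Fin (N + 1) → k) →ₗ[k] (Fin (N + 1) → k) where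
  toFun u i := if (i : ℕ) % 2 = 0 then
      (if hi : (i : ℕ) + 1 < N + 1 then s i * u i + c * (s ⟨(i : ℕ) + 1, hi⟩ * u ⟨(i : ℕ) + 1, hi⟩)
        else h * (s i * u i))
    else (s ⟨(i : ℕ) - 1, by omega⟩ * u ⟨(i : ℕ) - 1, by omega⟩ - c * (s i * u i)) * (2 : k)⁻¹
  map_add' u u' := by
    funext i
    simp only [Pi.add_apply]
    split_ifs <;> ring
  map_smul' a u := by
    funext i
    simp only [Pi.smul_apply, smul_eq_mul, RingHom.id_apply]
    split_ifs <;> ring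

/-- Auxiliary computation (`toSplitMap_apply_even`). [folklore] -/
theorem toSplitMap_apply_even (s : Fin (N + 1) → k) (c h : k) (u : Fin (N + 1) → k)
    {i : Fin (N + 1)} (hi : (i : ℕ) % 2 = 0) (hi' : (i : ℕ) + 1 < N + 1) :
    toSplitMap s c h u i = s i * u i + c * (s ⟨(i : ℕ) + 1, hi'⟩ * u ⟨(i : ℕ) + 1, hi'⟩) := by
  change (if (i : ℕ) % 2 = 0 then _ else _) = _
  rw [if_pos hi, dif_pos hi']

/-- Auxiliary computation (`toSplitMap_apply_last`). [folklore] -/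
theorem toSplitMap_apply_last (s : Fin (N + 1) → k) (c h : k) (u : Fin (N + 1) → k)
    {i : Fin (N + 1)} (hi : (i : ℕ) % 2 = 0) (hi' : ¬ (i : ℕ) + 1 < N + 1) :
    toSplitMap s c h u i = h * (s i * u i) := by
  change (if (i : ℕ) % 2 = 0 then _ else _) = _
  rw [if_pos hi, dif_neg hi']

/-- Auxiliary computation (`toSplitMap_apply_odd`). [folklore] -/
theorem toSplitMap_apply_odd (s : Fin (N + 1) → k) (c h : k) (u : Fin (N + 1) → k)
    {i : Fin (N + 1)} (hi : ¬ (i : ℕ) % 2 = 0) :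
    toSplitMap s c h u i =
      (s ⟨(i : ℕ) - 1, by omega⟩ * u ⟨(i : ℕ) - 1, by omega⟩ - c * (s i * u i)) * (2 : k)⁻¹ := by
  change (if (i : ℕ) % 2 = 0 then _ else _) = _
  rw [if_neg hi]

/-- `splitForm (L u) = ½ Σ sᵢ² uᵢ²`. [folklore] -/
theorem eval_splitForm_toSplitMap (s : Fin (N + 1) → k) {c h : k} (hc : c * c = -1)
    (hh : h * h = (2 : k)⁻¹) (u : Fin (N + 1) → k) :
    MvPolynomial.eval (toSplitMap s c h u) (splitForm k N) =
      (2 : k)⁻¹ * ∑ i, s i * s i * (u i * u i) := by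
  rw [eval_splitForm, Finset.mul_sum, sum_eq_sum_pairs (fun i ↦ (2 : k)⁻¹ * (s i * s i * (u i * u i)))]
  refine Finset.sum_congr rfl fun i _ ↦ ?_
  by_cases hi : (i : ℕ) % 2 = 0
  · rw [if_pos hi, if_pos hi]
    by_cases hi' : (i : ℕ) + 1 < N + 1
    · rw [dif_pos hi', dif_pos hi', toSplitMap_apply_even s c h u hi hi',
        toSplitMap_apply_odd s c h u (i := ⟨(i : ℕ) + 1, hi'⟩) (by simp; omega)]
      have hidx : (⟨((⟨(i : ℕ) + 1, hi'⟩ : Fin (N + 1)) : ℕ) - 1, by simp; omega⟩ : Fin (N + 1)) = i :=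
        Fin.ext (by simp)
      rw [hidx]
      linear_combination (-(2 : k)⁻¹ * (s ⟨(i : ℕ) + 1, hi'⟩ * u ⟨(i : ℕ) + 1, hi'⟩) ^ 2) * hc
    · rw [dif_neg hi', dif_neg hi', toSplitMap_apply_last s c h u hi hi', add_zero]
      linear_combination (s i * u i) ^ 2 * hh
  · rw [if_neg hi, if_neg hi]

/-- The map `u ↦ y` is injective (`sᵢ ≠ 0`, `h ≠ 0`, `2 ≠ 0`). [folklore] -/
theorem toSplitMap_injective {s : Fin (N + 1) → k} (hs : ∀ i, s i ≠ 0) {c h : k}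
    (hc : c * c = -1) (hh0 : h ≠ 0) (h2 : (2 : k) ≠ 0) :
    Function.Injective (toSplitMap s c h) := by
  have hc0 : c ≠ 0 := by rintro rfl; simp at hc
  rw [← LinearMap.ker_eq_bot, LinearMap.ker_eq_bot']
  intro u hu
  have hv := congrFun hu
  have htwo : ∀ x : k, 2 * x = 0 → x = 0 := fun x hx ↦ (mul_eq_zero.mp hx).resolve_left h2
  -- even indices with a partner, and their partners
  have hpair : ∀ i : Fin (N + 1), (i : ℕ) % 2 = 0 → ∀ hi' : (i : ℕ) + 1 < N + 1,
      u i = 0 ∧ u ⟨(i : ℕ) + 1, hi'⟩ = 0 := by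
    intro i hi hi'
    have h0 := hv i
    have h1 := hv ⟨(i : ℕ) + 1, hi'⟩
    rw [toSplitMap_apply_even s c h u hi hi', Pi.zero_apply] at h0
    rw [toSplitMap_apply_odd s c h u (i := ⟨(i : ℕ) + 1, hi'⟩) (by simp; omega), Pi.zero_apply,
      mul_eq_zero, inv_eq_zero, or_iff_left h2] at h1
    have hidx : (⟨((⟨(i : ℕ) + 1, hi'⟩ : Fin (N + 1)) : ℕ) - 1, by simp; omega⟩ : Fin (N + 1)) = i :=
      Fin.ext (by simp)
    rw [hidx] at h1
    have hu0 : s i * u i = 0 := htwo _ (by linear_combination h0 + h1)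
    have hu1 : c * (s ⟨(i : ℕ) + 1, hi'⟩ * u ⟨(i : ℕ) + 1, hi'⟩) = 0 :=
      htwo _ (by linear_combination h0 - h1)
    simp only [mul_eq_zero, hs, hc0, false_or] at hu0 hu1
    exact ⟨hu0, hu1⟩
  funext j
  rw [Pi.zero_apply]
  by_cases hj : (j : ℕ) % 2 = 0
  · by_cases hj' : (j : ℕ) + 1 < N + 1
    · exact (hpair j hj hj').1
    · have h0 := hv j
      rw [toSplitMap_apply_last s c h u hj hj', Pi.zero_apply] at h0
      simpa [mul_eq_zero, hs, hh0] using h0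
  · -- `j` odd: partner of `j - 1`
    have hj1 : ((⟨(j : ℕ) - 1, by omega⟩ : Fin (N + 1)) : ℕ) % 2 = 0 := by simp; omega
    have hj2 : ((⟨(j : ℕ) - 1, by omega⟩ : Fin (N + 1)) : ℕ) + 1 < N + 1 := by simp; omega
    have h := (hpair ⟨(j : ℕ) - 1, by omega⟩ hj1 hj2).2
    have hidx : (⟨((⟨(j : ℕ) - 1, by omega⟩ : Fin (N + 1)) : ℕ) + 1, hj2⟩ : Fin (N + 1)) = j :=
      Fin.ext (by simp; omega)
    rwa [hidx] at h

variable [IsAlgClosed k]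

/-- **Normal form of a nonsingular quadratic form** over an algebraically closed field of
characteristic `≠ 2`: an invertible matrix `A` with `F(v) = splitForm (A v)` for all `v`.
[cite: Hartshorne1977, I Ex. 5.8] -/
theorem exists_matrix_eval_eq_eval_splitForm (h2 : (2 : k) ≠ 0) {F : MvPolynomial (Fin (N + 1)) k}
    (hF : F.IsHomogeneous 2) (hJ : IsNonsingularSystem k (fun _ : Fin 1 ↦ F)) :
    ∃ A : Matrix (Fin (N + 1)) (Fin (N + 1)) k, IsUnit A ∧
      ∀ v, MvPolynomial.eval v F = MvPolynomial.eval (A *ᵥ v) (splitForm k N) := by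
  classical
  haveI : Invertible (2 : k) := invertibleOfNonzero h2
  let B : LinearMap.BilinForm k (Fin (N + 1) → k) := Matrix.toLinearMap₂' k (hessian F)
  have hB : ∀ x y, B x y = x ⬝ᵥ (hessian F *ᵥ y) := fun x y ↦ Matrix.toLinearMap₂'_apply' _ _ _
  have hBsymm : ∀ x y, B x y = B y x := fun x y ↦ by
    rw [hB, hB, Matrix.dotProduct_mulVec, ← Matrix.mulVec_transpose, hessian_transpose,
      dotProduct_comm]
  let Q : QuadraticForm k (Fin (N + 1) → k) := B.toQuadraticMap
  have hQ : ∀ v, Q v = 2 * MvPolynomial.eval v F := fun v ↦ by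
    rw [LinearMap.BilinMap.toQuadraticMap_apply, hB, two_mul_eval_eq hF]
  have hassoc : QuadraticMap.associated (R := k) Q = B :=
    QuadraticMap.associated_left_inverse k hBsymm
  have hsep : (QuadraticMap.associated (R := k) Q).SeparatingLeft := by
    rw [hassoc]
    intro x hx
    have hMx : hessian F *ᵥ x = 0 := by
      funext l
      have h := hx (Pi.single l 1)
      rw [hBsymm, hB, single_dotProduct, one_mul] at h
      exact h
    have h0 : hessian F *ᵥ x = hessian F *ᵥ 0 := by rw [hMx, Matrix.mulVec_zero]
    exact mulVec_hessian_injective hF h2 hJ h0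
  obtain ⟨w, ⟨E⟩⟩ := Q.equivalent_weightedSumSquares_units_of_nondegenerate' hsep
  have hd : Module.finrank k (Fin (N + 1) → k) = N + 1 := Module.finrank_fin_fun k
  let eN : Fin (Module.finrank k (Fin (N + 1) → k)) ≃ Fin (N + 1) := finCongr hd
  have hsq : ∀ i : Fin (N + 1), ∃ z : k, (w (eN.symm i) : k) = z * z := fun i ↦
    IsAlgClosed.exists_eq_mul_self _
  choose s hs using hsq
  have hs0 : ∀ i, s i ≠ 0 := fun i h ↦ (w (eN.symm i)).ne_zero (by rw [hs i, h, mul_zero])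
  obtain ⟨c, hc⟩ := IsAlgClosed.exists_eq_mul_self (-1 : k)
  obtain ⟨h, hh⟩ := IsAlgClosed.exists_eq_mul_self ((2 : k)⁻¹)
  have hh0 : h ≠ 0 := fun h0 ↦ by rw [h0, mul_zero] at hh; exact (inv_ne_zero h2) hh
  let R : (Fin (Module.finrank k (Fin (N + 1) → k)) → k) →ₗ[k] (Fin (N + 1) → k) :=
    (LinearEquiv.funCongrLeft k k eN.symm).toLinearMap
  have hR : ∀ x i, R x i = x (eN.symm i) := fun x i ↦ rfl
  let Φ : (Fin (N + 1) → k) →ₗ[k] (Fin (N + 1) → k) :=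
    (toSplitMap s c h).comp (R.comp E.toLinearEquiv.toLinearMap)
  refine ⟨LinearMap.toMatrix' Φ, ?_, fun v ↦ ?_⟩
  · rw [← Matrix.mulVec_injective_iff_isUnit]
    have hΦ : Function.Injective Φ :=
      (toSplitMap_injective hs0 hc.symm hh0 h2).comp
        ((LinearEquiv.funCongrLeft k k eN.symm).injective.comp E.toLinearEquiv.injective)
    intro x y hxy
    rw [LinearMap.toMatrix'_mulVec, LinearMap.toMatrix'_mulVec] at hxy
    exact hΦ hxy
  · rw [LinearMap.toMatrix'_mulVec]
    change MvPolynomial.eval v F = MvPolynomial.eval (toSplitMap s c h (R (E v))) (splitForm k N)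
    rw [eval_splitForm_toSplitMap s hc.symm hh.symm]
    have hE := E.map_app v
    rw [QuadraticMap.weightedSumSquares_apply, hQ] at hE
    have hsum : ∑ i, s i * s i * (R (E v) i * R (E v) i) = ∑ i, w i • ((E v) i * (E v) i) := by
      rw [← eN.symm.sum_comp]
      refine Finset.sum_congr rfl fun i _ ↦ ?_
      rw [hR, ← hs i, Units.smul_def, smul_eq_mul]
    rw [hsum, hE, ← mul_assoc, inv_mul_cancel₀ h2, one_mul]

/-- **A smooth quadric is projectively equivalent to the split quadric**: for a nonsingular
quadratic form `F(x₀, …, x_N)` over an algebraically closed field with `2 ≠ 0` there is an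
invertible linear substitution `τ` (with inverse `τ'`) such that `σ_τ(splitForm) = F`.
[cite: Hartshorne1977, I Ex. 5.8] -/
theorem exists_linearSubst_splitForm (h2 : (2 : k) ≠ 0) {F : MvPolynomial (Fin (N + 1)) k}
    (hF : F.IsHomogeneous 2) (hJ : IsNonsingularSystem k (fun _ : Fin 1 ↦ F)) :
    ∃ τ τ' : Fin (N + 1) → MvPolynomial (Fin (N + 1)) k,
      (∀ j, (τ j).IsHomogeneous 1) ∧ (∀ j, (τ' j).IsHomogeneous 1) ∧
        (∀ p, MvPolynomial.aeval τ (MvPolynomial.aeval τ' p) = p) ∧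
          (∀ p, MvPolynomial.aeval τ' (MvPolynomial.aeval τ p) = p) ∧
            LinearIndependent k τ ∧ MvPolynomial.aeval τ (splitForm k N) = F := by
  classical
  obtain ⟨A, hA, hAF⟩ := exists_matrix_eval_eq_eval_splitForm h2 hF hJ
  have hli : LinearIndependent k A.row := Matrix.linearIndependent_rows_iff_isUnit.mpr hA
  let b := basisOfLinearIndependentOfCardEqFinrank hli (by simp)
  have hb : ∀ j, b j = A j := fun j ↦ by
    rw [coe_basisOfLinearIndependentOfCardEqFinrank]; rfl
  obtain ⟨τ', hτ, hτ', hinv, hinv', hτli⟩ := exists_linearSubst_of_basis b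
  refine ⟨fun j ↦ lin (b j), τ', hτ, hτ', hinv, hinv', hτli, ?_⟩
  refine MvPolynomial.funext fun v ↦ ?_
  rw [MvPolynomial.aeval_eq_bind₁, show MvPolynomial.eval v (MvPolynomial.bind₁ (fun j ↦ lin (b j))
    (splitForm k N)) = MvPolynomial.eval (fun j ↦ MvPolynomial.eval v (lin (b j))) (splitForm k N)
    from MvPolynomial.eval₂Hom_bind₁ _ _ _ _, hAF v]
  have hfun : (fun j ↦ MvPolynomial.eval v (lin (b j))) = A *ᵥ v := by
    refine _root_.funext fun j ↦ ?_
    rw [eval_lin, hb]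
    rfl
  rw [hfun]

end SplitForm

/-! ### Possibly degenerate forms: the split form of rank `r` -/

section Rank

variable {k : Type u} [Field k] {N : ℕ}

/-- **Sorting a decidable predicate on `Fin (N + 1)` to the front** by a permutation. [folklore] -/
theorem exists_perm_iff_lt (p : Fin (N + 1) → Prop) [DecidablePred p] :
    ∃ (r : ℕ) (_ : r ≤ N + 1) (π : Equiv.Perm (Fin (N + 1))), ∀ i, p (π i) ↔ (i : ℕ) < r := by
  classical
  let r := Fintype.card {i // p i}
  have hr : r ≤ N + 1 := (Fintype.card_subtype_le p).trans (by simp)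
  have hc : Fintype.card {i // ¬ p i} = N + 1 - r := by
    rw [Fintype.card_subtype_compl, Fintype.card_fin]
  let e₁ : Fin r ≃ {i // p i} := (Fintype.equivFinOfCardEq rfl).symm
  let e₂ : Fin (N + 1 - r) ≃ {i // ¬ p i} := (Fintype.equivFinOfCardEq hc).symm
  let E : Fin (N + 1) ≃ Fin r ⊕ Fin (N + 1 - r) :=
    (finCongr (show N + 1 = r + (N + 1 - r) by omega)).trans finSumFinEquiv.symm
  refine ⟨r, hr, E.trans ((e₁.sumCongr e₂).trans (Equiv.sumCompl p)), fun i ↦ ?_⟩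
  simp only [Equiv.trans_apply]
  by_cases hi : (i : ℕ) < r
  · have hE : E i = Sum.inl ⟨i, hi⟩ := by
      simp only [E, Equiv.trans_apply]
      rw [show finCongr (show N + 1 = r + (N + 1 - r) by omega) i = Fin.castAdd (N + 1 - r) ⟨i, hi⟩
        from Fin.ext rfl, finSumFinEquiv_symm_apply_castAdd]
    rw [hE, Equiv.sumCongr_apply, Sum.map_inl, Equiv.sumCompl_apply_inl]
    exact ⟨fun _ ↦ hi, fun _ ↦ (e₁ ⟨i, hi⟩).2⟩
  · have hE : E i = Sum.inr ⟨i - r, by omega⟩ := by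
      simp only [E, Equiv.trans_apply]
      rw [show finCongr (show N + 1 = r + (N + 1 - r) by omega) i = Fin.natAdd r ⟨i - r, by omega⟩
        from Fin.ext (by simp; omega), finSumFinEquiv_symm_apply_natAdd]
    rw [hE, Equiv.sumCongr_apply, Sum.map_inr, Equiv.sumCompl_apply_inr]
    exact ⟨fun h ↦ absurd h (e₂ ⟨i - r, _⟩).2, fun h ↦ absurd h hi⟩

/-- **The explicit equivalence `Σ_{i<r} sᵢ²uᵢ² ↦ 2 · splitFormAt 0 r`** (identity on the coordinates
`i ≥ r`). [folklore] -/
def toSplitMapR (r : ℕ) (hr : r ≤ N + 1) (s : Fin (N + 1) → k) (c h : k) :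
    (Fin (N + 1) → k) →ₗ[k] (Fin (N + 1) → k) where
  toFun u i := if (i : ℕ) < r then
      (if (i : ℕ) % 2 = 0 then
        (if hi : (i : ℕ) + 1 < r then s i * u i + c * (s ⟨(i : ℕ) + 1, by omega⟩ * u ⟨(i : ℕ) + 1, by omega⟩)
          else h * (s i * u i))
      else (s ⟨(i : ℕ) - 1, by omega⟩ * u ⟨(i : ℕ) - 1, by omega⟩ - c * (s i * u i)) * (2 : k)⁻¹)
    else u i
  map_add' u u' := by
    funext i
    simp only [Pi.add_apply]
    split_ifs <;> ring
  map_smul' a u := by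
    funext i
    simp only [Pi.smul_apply, smul_eq_mul, RingHom.id_apply]
    split_ifs <;> ring

/-- Auxiliary computation (`toSplitMapR_apply_even`). [folklore] -/
theorem toSplitMapR_apply_even {r : ℕ} (hr : r ≤ N + 1) (s : Fin (N + 1) → k) (c h : k)
    (u : Fin (N + 1) → k) {i : Fin (N + 1)} (hi : (i : ℕ) % 2 = 0) (hi' : (i : ℕ) + 1 < r) :
    toSplitMapR r hr s c h u i = s i * u i + c * (s ⟨(i : ℕ) + 1, by omega⟩ * u ⟨(i : ℕ) + 1, by omega⟩) := by
  change (if (i : ℕ) < r then _ else _) = _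
  rw [if_pos (by omega), if_pos hi, dif_pos hi']

/-- Auxiliary computation (`toSplitMapR_apply_last`). [folklore] -/
theorem toSplitMapR_apply_last {r : ℕ} (hr : r ≤ N + 1) (s : Fin (N + 1) → k) (c h : k)
    (u : Fin (N + 1) → k) {i : Fin (N + 1)} (hir : (i : ℕ) < r) (hi : (i : ℕ) % 2 = 0)
    (hi' : ¬ (i : ℕ) + 1 < r) : toSplitMapR r hr s c h u i = h * (s i * u i) := by
  change (if (i : ℕ) < r then _ else _) = _
  rw [if_pos hir, if_pos hi, dif_neg hi']

/-- Auxiliary computation (`toSplitMapR_apply_odd`). [folklore] -/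
theorem toSplitMapR_apply_odd {r : ℕ} (hr : r ≤ N + 1) (s : Fin (N + 1) → k) (c h : k)
    (u : Fin (N + 1) → k) {i : Fin (N + 1)} (hir : (i : ℕ) < r) (hi : ¬ (i : ℕ) % 2 = 0) :
    toSplitMapR r hr s c h u i =
      (s ⟨(i : ℕ) - 1, by omega⟩ * u ⟨(i : ℕ) - 1, by omega⟩ - c * (s i * u i)) * (2 : k)⁻¹ := by
  change (if (i : ℕ) < r then _ else _) = _
  rw [if_pos hir, if_neg hi]

/-- Auxiliary computation (`toSplitMapR_apply_ge`). [folklore] -/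
theorem toSplitMapR_apply_ge {r : ℕ} (hr : r ≤ N + 1) (s : Fin (N + 1) → k) (c h : k)
    (u : Fin (N + 1) → k) {i : Fin (N + 1)} (hir : ¬ (i : ℕ) < r) : toSplitMapR r hr s c h u i = u i := by
  change (if (i : ℕ) < r then _ else _) = _
  rw [if_neg hir]

/-- `splitFormAt 0 r (L u) = ½ Σ_{i<r} sᵢ² uᵢ²`. [folklore] -/
theorem eval_splitFormAt_toSplitMapR {r : ℕ} (hr : r ≤ N + 1) (s : Fin (N + 1) → k) {c h : k}
    (hc : c * c = -1) (hh : h * h = (2 : k)⁻¹) (u : Fin (N + 1) → k) :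
    MvPolynomial.eval (toSplitMapR r hr s c h u) (splitFormAt k 0 r (by omega)) =
      (2 : k)⁻¹ * ∑ i : Fin (N + 1), if (i : ℕ) < r then s i * s i * (u i * u i) else 0 := by
  rw [eval_splitFormAt, Finset.mul_sum,
    sum_eq_sum_pairs (fun i : Fin (N + 1) ↦ (2 : k)⁻¹ * if (i : ℕ) < r then s i * s i * (u i * u i) else 0)]
  refine Finset.sum_congr rfl fun i _ ↦ ?_
  by_cases hi : (i : ℕ) % 2 = 0
  · rw [if_pos hi]
    by_cases hir : (i : ℕ) < r
    · rw [if_pos ⟨Nat.zero_le _, by omega, by simpa using hi⟩, if_pos hir]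
      by_cases hi' : (i : ℕ) + 1 < 0 + r
      · rw [dif_pos hi', dif_pos (by omega), if_pos (by simp; omega),
          toSplitMapR_apply_even hr s c h u hi (by omega),
          toSplitMapR_apply_odd hr s c h u (i := ⟨(i : ℕ) + 1, by omega⟩) (by simp; omega) (by simp; omega)]
        have hidx : (⟨((⟨(i : ℕ) + 1, by omega⟩ : Fin (N + 1)) : ℕ) - 1, by simp; omega⟩ : Fin (N + 1)) = i :=
          Fin.ext (by simp)
        rw [hidx]
        linear_combination (-(2 : k)⁻¹ * (s ⟨(i : ℕ) + 1, by omega⟩ * u ⟨(i : ℕ) + 1, by omega⟩) ^ 2) * hc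
      · rw [dif_neg hi', toSplitMapR_apply_last hr s c h u hir hi (by omega)]
        by_cases hi2 : (i : ℕ) + 1 < N + 1
        · rw [dif_pos hi2, if_neg (by simp; omega), mul_zero, add_zero]
          linear_combination (s i * u i) ^ 2 * hh
        · rw [dif_neg hi2, add_zero]
          linear_combination (s i * u i) ^ 2 * hh
    · rw [if_neg (by omega), if_neg hir, mul_zero, zero_add]
      by_cases hi2 : (i : ℕ) + 1 < N + 1
      · rw [dif_pos hi2, if_neg (by simp; omega), mul_zero]
      · rw [dif_neg hi2]
  · rw [if_neg hi, if_neg]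
    omega

/-- The rank-`r` map is injective (`sᵢ ≠ 0` for `i < r`, `h ≠ 0`, `2 ≠ 0`). [folklore] -/
theorem toSplitMapR_injective {r : ℕ} (hr : r ≤ N + 1) {s : Fin (N + 1) → k}
    (hs : ∀ i : Fin (N + 1), (i : ℕ) < r → s i ≠ 0) {c h : k}
    (hc : c * c = -1) (hh0 : h ≠ 0) (h2 : (2 : k) ≠ 0) :
    Function.Injective (toSplitMapR r hr s c h) := by
  have hc0 : c ≠ 0 := by rintro rfl; simp at hc
  rw [← LinearMap.ker_eq_bot, LinearMap.ker_eq_bot']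
  intro u hu
  have hv := congrFun hu
  have htwo : ∀ x : k, 2 * x = 0 → x = 0 := fun x hx ↦ (mul_eq_zero.mp hx).resolve_left h2
  have hpair : ∀ i : Fin (N + 1), (i : ℕ) % 2 = 0 → ∀ hi' : (i : ℕ) + 1 < r,
      u i = 0 ∧ u ⟨(i : ℕ) + 1, by omega⟩ = 0 := by
    intro i hi hi'
    have h0 := hv i
    have h1 := hv ⟨(i : ℕ) + 1, by omega⟩
    rw [toSplitMapR_apply_even hr s c h u hi hi', Pi.zero_apply] at h0
    rw [toSplitMapR_apply_odd hr s c h u (i := ⟨(i : ℕ) + 1, by omega⟩) (by simp; omega) (by simp; omega),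
      Pi.zero_apply, mul_eq_zero, inv_eq_zero, or_iff_left h2] at h1
    have hidx : (⟨((⟨(i : ℕ) + 1, by omega⟩ : Fin (N + 1)) : ℕ) - 1, by simp; omega⟩ : Fin (N + 1)) = i :=
      Fin.ext (by simp)
    rw [hidx] at h1
    have hu0 : s i * u i = 0 := htwo _ (by linear_combination h0 + h1)
    have hu1 : c * (s ⟨(i : ℕ) + 1, by omega⟩ * u ⟨(i : ℕ) + 1, by omega⟩) = 0 :=
      htwo _ (by linear_combination h0 - h1)
    simp only [mul_eq_zero, hs i (by omega), hs ⟨(i : ℕ) + 1, by omega⟩ (by simp; omega), hc0,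
      false_or] at hu0 hu1
    exact ⟨hu0, hu1⟩
  funext j
  rw [Pi.zero_apply]
  by_cases hjr : (j : ℕ) < r
  · by_cases hj : (j : ℕ) % 2 = 0
    · by_cases hj' : (j : ℕ) + 1 < r
      · exact (hpair j hj hj').1
      · have h0 := hv j
        rw [toSplitMapR_apply_last hr s c h u hjr hj hj', Pi.zero_apply] at h0
        simpa [mul_eq_zero, hs j hjr, hh0] using h0
    · have hj1 : ((⟨(j : ℕ) - 1, by omega⟩ : Fin (N + 1)) : ℕ) % 2 = 0 := by simp; omega
      have hj2 : ((⟨(j : ℕ) - 1, by omega⟩ : Fin (N + 1)) : ℕ) + 1 < r := by simp; omega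
      have h := (hpair ⟨(j : ℕ) - 1, by omega⟩ hj1 hj2).2
      have hidx : (⟨((⟨(j : ℕ) - 1, by omega⟩ : Fin (N + 1)) : ℕ) + 1, by simp; omega⟩ : Fin (N + 1)) = j :=
        Fin.ext (by simp; omega)
      rwa [hidx] at h
  · have h0 := hv j
    rwa [toSplitMapR_apply_ge hr s c h u hjr, Pi.zero_apply] at h0

variable [IsAlgClosed k]

/-- **Normal form of an arbitrary quadratic form** over an algebraically closed field of
characteristic `≠ 2`: an invertible matrix `A` and a rank `r` with `F(v) = (x₀x₁ + ⋯)_{r}(A v)`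
(the split form on the first `r` variables). [folklore] -/
theorem exists_matrix_eval_eq_eval_splitFormAt_rank (h2 : (2 : k) ≠ 0) {F : MvPolynomial (Fin (N + 1)) k}
    (hF : F.IsHomogeneous 2) :
    ∃ (r : ℕ) (hr : r ≤ N + 1) (A : Matrix (Fin (N + 1)) (Fin (N + 1)) k), IsUnit A ∧
      ∀ v, MvPolynomial.eval v F = MvPolynomial.eval (A *ᵥ v) (splitFormAt k 0 r (by omega)) := by
  classical
  haveI : Invertible (2 : k) := invertibleOfNonzero h2
  let B : LinearMap.BilinForm k (Fin (N + 1) → k) := Matrix.toLinearMap₂' k (hessian F)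
  have hB : ∀ x y, B x y = x ⬝ᵥ (hessian F *ᵥ y) := fun x y ↦ Matrix.toLinearMap₂'_apply' _ _ _
  let Q : QuadraticForm k (Fin (N + 1) → k) := B.toQuadraticMap
  have hQ : ∀ v, Q v = 2 * MvPolynomial.eval v F := fun v ↦ by
    rw [LinearMap.BilinMap.toQuadraticMap_apply, hB, two_mul_eval_eq hF]
  obtain ⟨w, ⟨E⟩⟩ := Q.equivalent_weightedSumSquares
  have hd : Module.finrank k (Fin (N + 1) → k) = N + 1 := Module.finrank_fin_fun k
  let eN : Fin (Module.finrank k (Fin (N + 1) → k)) ≃ Fin (N + 1) := finCongr hd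
  let w' : Fin (N + 1) → k := fun i ↦ w (eN.symm i)
  -- sort the nonzero weights to the front
  obtain ⟨r, hr, π, hπ⟩ := exists_perm_iff_lt (fun i ↦ w' i ≠ 0)
  -- square roots
  have hsq : ∀ i : Fin (N + 1), ∃ z : k, w' (π i) = z * z := fun i ↦ IsAlgClosed.exists_eq_mul_self _
  choose s hs using hsq
  have hs0 : ∀ i : Fin (N + 1), (i : ℕ) < r → s i ≠ 0 := fun i hi h0 ↦
    (hπ i).mpr hi (by rw [hs i, h0, mul_zero])
  obtain ⟨c, hc⟩ := IsAlgClosed.exists_eq_mul_self (-1 : k)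
  obtain ⟨h, hh⟩ := IsAlgClosed.exists_eq_mul_self ((2 : k)⁻¹)
  have hh0 : h ≠ 0 := fun h0 ↦ by rw [h0, mul_zero] at hh; exact (inv_ne_zero h2) hh
  -- the composite linear map
  let R : (Fin (Module.finrank k (Fin (N + 1) → k)) → k) →ₗ[k] (Fin (N + 1) → k) :=
    (LinearEquiv.funCongrLeft k k eN.symm).toLinearMap
  have hR : ∀ x i, R x i = x (eN.symm i) := fun x i ↦ rfl
  let P : (Fin (N + 1) → k) →ₗ[k] (Fin (N + 1) → k) := (LinearEquiv.funCongrLeft k k π).toLinearMap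
  have hP : ∀ x i, P x i = x (π i) := fun x i ↦ rfl
  let Φ : (Fin (N + 1) → k) →ₗ[k] (Fin (N + 1) → k) :=
    (toSplitMapR r hr s c h).comp (P.comp (R.comp E.toLinearEquiv.toLinearMap))
  refine ⟨r, hr, LinearMap.toMatrix' Φ, ?_, fun v ↦ ?_⟩
  · rw [← Matrix.mulVec_injective_iff_isUnit]
    have hΦ : Function.Injective Φ :=
      (toSplitMapR_injective hr hs0 hc.symm hh0 h2).comp
        ((LinearEquiv.funCongrLeft k k π).injective.comp
          ((LinearEquiv.funCongrLeft k k eN.symm).injective.comp E.toLinearEquiv.injective))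
    intro x y hxy
    rw [LinearMap.toMatrix'_mulVec, LinearMap.toMatrix'_mulVec] at hxy
    exact hΦ hxy
  · rw [LinearMap.toMatrix'_mulVec]
    change MvPolynomial.eval v F =
      MvPolynomial.eval (toSplitMapR r hr s c h (P (R (E v)))) (splitFormAt k 0 r _)
    rw [eval_splitFormAt_toSplitMapR hr s hc.symm hh.symm]
    have hE := E.map_app v
    rw [QuadraticMap.weightedSumSquares_apply, hQ] at hE
    have hsum : ∑ i : Fin (N + 1), (if (i : ℕ) < r then s i * s i * (P (R (E v)) i * P (R (E v)) i) else 0) =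
        ∑ j, w j • ((E v) j * (E v) j) := by
      rw [← Equiv.sum_comp (π.trans eN.symm) (fun j ↦ w j • ((E v) j * (E v) j))]
      refine Finset.sum_congr rfl fun i _ ↦ ?_
      simp only [Equiv.trans_apply, smul_eq_mul, hP, hR]
      by_cases hir : (i : ℕ) < r
      · rw [if_pos hir, ← hs i]
      · rw [if_neg hir]
        have h0 : w' (π i) = 0 := by
          by_contra hne
          exact hir ((hπ i).mp hne)
        change (0 : k) = w' (π i) * _
        rw [h0, zero_mul]
    rw [hsum, hE, ← mul_assoc, inv_mul_cancel₀ h2, one_mul]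

/-- **Substitution form of the rank normal form**: an invertible linear substitution `τ` and a rank
`r` with `σ_τ(splitFormAt 0 r) = F`, for any quadratic form `F`. [folklore] -/
theorem exists_linearSubst_splitFormAt_rank (h2 : (2 : k) ≠ 0) {F : MvPolynomial (Fin (N + 1)) k}
    (hF : F.IsHomogeneous 2) :
    ∃ (r : ℕ) (hr : r ≤ N + 1) (τ τ' : Fin (N + 1) → MvPolynomial (Fin (N + 1)) k),
      (∀ j, (τ j).IsHomogeneous 1) ∧ (∀ j, (τ' j).IsHomogeneous 1) ∧
        (∀ p, MvPolynomial.aeval τ (MvPolynomial.aeval τ' p) = p) ∧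
          (∀ p, MvPolynomial.aeval τ' (MvPolynomial.aeval τ p) = p) ∧
            LinearIndependent k τ ∧ MvPolynomial.aeval τ (splitFormAt k 0 r (by omega)) = F := by
  classical
  obtain ⟨r, hr, A, hA, hAF⟩ := exists_matrix_eval_eq_eval_splitFormAt_rank h2 hF
  have hli : LinearIndependent k A.row := Matrix.linearIndependent_rows_iff_isUnit.mpr hA
  let b := basisOfLinearIndependentOfCardEqFinrank hli (by simp)
  have hb : ∀ j, b j = A j := fun j ↦ by
    rw [coe_basisOfLinearIndependentOfCardEqFinrank]; rfl
  obtain ⟨τ', hτ, hτ', hinv, hinv', hτli⟩ := exists_linearSubst_of_basis b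
  refine ⟨r, hr, fun j ↦ lin (b j), τ', hτ, hτ', hinv, hinv', hτli, ?_⟩
  refine MvPolynomial.funext fun v ↦ ?_
  rw [MvPolynomial.aeval_eq_bind₁, show MvPolynomial.eval v (MvPolynomial.bind₁ (fun j ↦ lin (b j))
    (splitFormAt k 0 r _)) = MvPolynomial.eval (fun j ↦ MvPolynomial.eval v (lin (b j))) (splitFormAt k 0 r _)
    from MvPolynomial.eval₂Hom_bind₁ _ _ _ _, hAF v]
  have hfun : (fun j ↦ MvPolynomial.eval v (lin (b j))) = A *ᵥ v := by
    refine _root_.funext fun j ↦ ?_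
    rw [eval_lin, hb]
    rfl
  rw [hfun]

end Rank

end ProjectiveSpaceCells

end Literature.AlgebraicGeometry.Motives
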